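import Literature.Analysis.FluidPDE.OseenMildDifferenceL2
import Literature.Analysis.FluidPDE.PerturbedEnergyInequality
import Literature.Analysis.FluidPDE.NormalisedPressureDifferenceMixed
import Literature.Analysis.FluidPDE.HeatFlowGigaL5
import Literature.Analysis.UnboundedOperators.HeatKernelBoundedData
import HarnessLib

/-!
# The remainder of the Calderón splitting is in the energy class up to the final time

Analysis/FluidPDE proofs file (theorems only) on the discharge path of the corrected form of
`Literature.Analysis.FluidPDE.albritton_singular_point_of_blowup` (Albritton 2018, proof of
Prop. 4.5, (4.32)–(4.33): "By the well-posedness theory for the equation as well as the energy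
inequality, one may prove that `U` is in the energy space up to the blow-up time:
`U ∈ L^∞_t L²_x ∩ L²_t Ḣ¹_x(Q_{T*})`"). Here `v` is a classical solution on `(-δ₀, S)` (bounded
on closed sub-slabs, `L^p` slices, satisfying the Oseen integral identities — as the classical
representative of a restarted member of Albritton's class does), `V` the long-lived factor
(`LongLivedOseenSolution.lean`: classical, `|V| ≤ M`, integral identities) with `v(0) − V₀ ∈ L²`.
Then `W = v − V` satisfies

  `∫ |W(t)|² ≤ 4‖v(0) − V₀‖²₂ e^{M²S}` for `0 < t < S`,
  `∫_{t₀}^{S} ∫ |∇W|² ≤ 4‖v(0) − V₀‖²₂ (1 + M²S) e^{M²S}` for `0 < t₀ < S`.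

* §1 One block: the `L²`-stability `eLpNorm_two_sub_le_of_oseenMild` with the free evolution of
  the difference of the data as `U_d`.
* §2 All blocks: induction over blocks of length `ℓ = ℓ(sup|v|, M)` on `(0, S₁)`, `S₁ < S`:
  `W(t) ∈ L²` with a (crude, `S₁`-dependent) bound.
* §3 The energy inequality (`PerturbedEnergyInequality.energy_inequality`, pressure hypothesis from
  `NormalisedPressureDifferenceMixed.exists_sq_integrable_pressure_sub`) upgrades the crude bound to
  the uniform one, and bounds the dissipation; `S₁ ↑ S` by monotone convergence.

## References

* D. Albritton, Anal. PDE 11 (2018) = arXiv:1612.04439, proof of Prop. 4.5, (4.32)–(4.33).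
  [Albritton2018]
* P. G. Lemarié-Rieusset, *The Navier–Stokes Problem in the 21st Century* (2016), Thm. 5.1,
  Prop. 15.1. [LemarieRieusset2016]
-/

noncomputable section

open MeasureTheory TopologicalSpace Set Function Filter Topology Metric
open scoped ENNReal NNReal Topology

namespace Literature.Analysis.FluidPDE

namespace RemainderEnergyClass

/-! ### §1 One block -/

section Block

/-- **One block of the `L²` bookkeeping.** Let `v`, `V` be jointly measurable on
`(s, T') × ℝ³`, bounded by `M'`, and satisfy the Oseen integral identities from time `s` with
continuous data `b_v`, `b_V` bounded by `M'`, `b_v − b_V ∈ L²`; if the block is short,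
`C M' · 2√(T' − s) ≤ 1/8` (`C` the constant of `eLpNorm_two_sub_le_of_oseenMild`), then
`v(t) − V(t) ∈ L²` with `‖v(t) − V(t)‖₂ ≤ 2‖b_v − b_V‖₂` for `s < t < T'` (the free evolution
`e^{(t−s)Δ}(b_v − b_V)` of the difference of the data is the `U_d` of the stability theorem:
jointly measurable, bounded by `2M'`, contracting in `L²`). [cite: Albritton2018, Prop. 4.5 proof, (4.32)–(4.33); LemarieRieusset2016, Thm. 5.1] -/
theorem block_step :
    ∃ C : ℝ, 0 < C ∧ ∀ {s T' M' : ℝ}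
      {v V : ℝ → EuclideanSpace ℝ (Fin 3) → EuclideanSpace ℝ (Fin 3)}
      {bv bV : EuclideanSpace ℝ (Fin 3) → EuclideanSpace ℝ (Fin 3)}, s < T' → 0 < M' →
      AEStronglyMeasurable (uncurry v)
        ((volume : Measure (ℝ × EuclideanSpace ℝ (Fin 3))).restrict (Ioo s T' ×ˢ univ)) →
      AEStronglyMeasurable (uncurry V)
        ((volume : Measure (ℝ × EuclideanSpace ℝ (Fin 3))).restrict (Ioo s T' ×ˢ univ)) →
      (∀ t ∈ Ioo s T', ∀ x, ‖v t x‖ ≤ M') → (∀ t ∈ Ioo s T', ∀ x, ‖V t x‖ ≤ M') →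
      Continuous bv → Continuous bV → (∀ x, ‖bv x‖ ≤ M') → (∀ x, ‖bV x‖ ≤ M') →
      MemLp (fun x => bv x - bV x) 2 volume →
      (∀ t ∈ Ioo s T', v t =ᵐ[volume] fun x =>
        UnboundedOperators.heatExtension bv (t - s) x - oseenDuhamel 1 s v v t x) →
      (∀ t ∈ Ioo s T', V t =ᵐ[volume] fun x =>
        UnboundedOperators.heatExtension bV (t - s) x - oseenDuhamel 1 s V V t x) →
      C * M' * (2 * Real.sqrt (T' - s)) ≤ 1 / 8 →
      ∀ t ∈ Ioo s T', AEStronglyMeasurable (fun x => v t x - V t x) volume ∧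
        eLpNorm (fun x => v t x - V t x) 2 volume ≤ 2 * eLpNorm (fun x => bv x - bV x) 2 volume := by
  obtain ⟨C, hC, hstab⟩ := OseenMildDifferenceL2.eLpNorm_two_sub_le_of_oseenMild
    (E := EuclideanSpace ℝ (Fin 3))
  refine ⟨C, hC, ?_⟩
  intro s T' M' v V bv bV hsT hM' hvm hVm hvbd hVbd hbvc hbVc hbvbd hbVbd hL2 hvid hVid hsmall
  -- the free evolution of the difference of the data
  set g : EuclideanSpace ℝ (Fin 3) → EuclideanSpace ℝ (Fin 3) := fun x => bv x - bV x with hg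
  have hgc : Continuous g := hbvc.sub hbVc
  have hgbd : ∀ x, ‖g x‖ ≤ 2 * M' := fun x =>
    (norm_sub_le _ _).trans (by linarith [hbvbd x, hbVbd x])
  set Ud : ℝ → EuclideanSpace ℝ (Fin 3) → EuclideanSpace ℝ (Fin 3) := fun t x =>
    UnboundedOperators.heatExtension g (t - s) x with hUd
  have hUdjm : StronglyMeasurable (uncurry Ud) := by
    have h := stronglyMeasurable_uncurry_heatExtension (F := EuclideanSpace ℝ (Fin 3)) hgc.stronglyMeasurable
    have hm : Measurable fun q : ℝ × EuclideanSpace ℝ (Fin 3) => (q.1 - s, q.2) :=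
      (measurable_fst.sub measurable_const).prodMk measurable_snd
    -- elaborate without expected type first (the target is not a higher-order pattern)
    have h2 := h.comp_measurable hm
    exact h2
  have hUdm : AEStronglyMeasurable (uncurry Ud)
      ((volume : Measure (ℝ × EuclideanSpace ℝ (Fin 3))).restrict (Ioo s T' ×ˢ univ)) :=
    hUdjm.aestronglyMeasurable
  have hUdbd : ∀ t ∈ Ioo s T', ∀ x, ‖Ud t x‖ ≤ 2 * M' := fun t ht x =>
    UnboundedOperators.norm_heatExtension_le hgbd (sub_pos.2 ht.1) x
  have hUdsl : ∀ t ∈ Ioo s T', AEStronglyMeasurable (Ud t) volume := fun t _ =>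
    (hUdjm.comp_measurable (measurable_const.prodMk measurable_id)).aestronglyMeasurable
  have hUdL2 : ∀ t ∈ Ioo s T', eLpNorm (Ud t) 2 volume ≤ eLpNorm g 2 volume := fun t ht =>
    UnboundedOperators.eLpNorm_heatExtension_le_holds hL2 one_le_two (sub_pos.2 ht.1)
  -- the identity for the difference
  have hW : ∀ t ∈ Ioo s T', (fun x => v t x - V t x) =ᵐ[volume] fun x =>
      Ud t x - (oseenDuhamel 1 s v v t x - oseenDuhamel 1 s V V t x) := by
    intro t ht
    filter_upwards [hvid t ht, hVid t ht] with x hxv hxV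
    rw [hxv, hxV, hUd]
    simp only [hg]
    rw [UnboundedOperators.heatExtension_sub_of_bound hbvc hbVc hbvbd hbVbd (sub_pos.2 ht.1) x]
    abel
  have hsmall' : C * M' * (1 : ℝ) ^ (-(1 / 2 : ℝ)) * (2 * Real.sqrt (T' - s)) ≤ 1 / 8 := by
    rw [Real.one_rpow, mul_one]; exact hsmall
  intro t ht
  exact hstab one_pos hsT hM' hvm hVm hUdm hvbd hVbd hUdbd hUdsl hUdL2 hW hsmall' t ht

end Block

/-! ### §2 All blocks: `W(t) ∈ L²` on `(0, S₁)`, `S₁ < S` -/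

section Blocks

variable {S δ₀ L : ℝ} {v V : ℝ → EuclideanSpace ℝ (Fin 3) → EuclideanSpace ℝ (Fin 3)}
  {V₀ : EuclideanSpace ℝ (Fin 3) → EuclideanSpace ℝ (Fin 3)}

/-- **The remainder is square integrable on every closed sub-slab** (crude bound): under the
hypotheses of the module docstring, for every `S₁ < S` there is `Λ₁` with `v(t) − V(t) ∈ L²`,
`‖v(t) − V(t)‖₂ ≤ Λ₁` for all `0 < t < S₁`, and `‖v(t) − V(t)‖₂ ≤ 2‖v(0) − V₀‖₂` on an initial
block `(0, ℓ)` (induction over blocks of length `ℓ`, `block_step`). [cite: Albritton2018, Prop. 4.5 proof, (4.32)–(4.33)] -/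
theorem sub_memLp_two_of_blocks (hδ₀ : 0 < δ₀) (hSL : S ≤ L)
    (hvc : ContinuousOn (uncurry v) (Ioo (-δ₀) S ×ˢ univ))
    (hvO : ∀ s t : ℝ, -δ₀ < s → s < t → t < S → v t =ᵐ[volume] fun x =>
      UnboundedOperators.heatExtension (v s) (t - s) x - oseenDuhamel 1 s v v t x)
    (hvbd : ∀ S₁, S₁ < S → ∃ Mv : ℝ, ∀ t ∈ Icc 0 S₁, ∀ x, ‖v t x‖ ≤ Mv)
    (hVc : ContinuousOn (uncurry V) (Ioo 0 L ×ˢ univ)) {M : ℝ} (hM : 0 < M)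
    (hVbd : ∀ t ∈ Ioo 0 L, ∀ x, ‖V t x‖ ≤ M) (hV₀c : Continuous V₀) (hV₀bd : ∀ x, ‖V₀ x‖ ≤ M)
    (hVeq : ∀ t ∈ Ioo 0 L, V t =ᵐ[volume] fun x =>
      UnboundedOperators.heatExtension V₀ t x - oseenDuhamel 1 0 V V t x)
    (hVO : ∀ s t : ℝ, 0 < s → s < t → t < L → V t =ᵐ[volume] fun x =>
      UnboundedOperators.heatExtension (V s) (t - s) x - oseenDuhamel 1 s V V t x)
    (hU₀ : MemLp (fun x => v 0 x - V₀ x) 2 volume) {S₁ : ℝ} (hS₁ : 0 < S₁) (hS₁S : S₁ < S) :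
    ∃ ℓ Λ₁ : ℝ, 0 < ℓ ∧
      (∀ t ∈ Ioo 0 S₁, MemLp (fun x => v t x - V t x) 2 volume ∧
        eLpNorm (fun x => v t x - V t x) 2 volume ≤ ENNReal.ofReal Λ₁) ∧
      (∀ t ∈ Ioo 0 (min ℓ S₁),
        eLpNorm (fun x => v t x - V t x) 2 volume ≤ 2 * eLpNorm (fun x => v 0 x - V₀ x) 2 volume) := by
  obtain ⟨C, hC, hblock⟩ := block_step
  obtain ⟨Mv, hMv⟩ := hvbd S₁ hS₁S
  set M' : ℝ := max (max Mv M) 1 with hM'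
  have hM'0 : 0 < M' := lt_of_lt_of_le one_pos (le_max_right _ _)
  have hMvM' : Mv ≤ M' := (le_max_left _ _).trans (le_max_left _ _)
  have hMM' : M ≤ M' := (le_max_right _ _).trans (le_max_left _ _)
  -- the block length
  set ℓ : ℝ := ((16 * C * M')⁻¹) ^ 2 with hℓ
  have hℓ0 : 0 < ℓ := by positivity
  have hsmall : ∀ {s T' : ℝ}, s < T' → T' - s ≤ ℓ → C * M' * (2 * Real.sqrt (T' - s)) ≤ 1 / 8 := by
    intro s T' hsT hle
    have h1 : Real.sqrt (T' - s) ≤ (16 * C * M')⁻¹ := by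
      rw [Real.sqrt_le_left (by positivity)]; exact hle
    calc C * M' * (2 * Real.sqrt (T' - s)) ≤ C * M' * (2 * (16 * C * M')⁻¹) := by gcongr
      _ = 1 / 8 := by field_simp; ring
  -- measurability and bounds of `v`, `V` on `(0, S₁)`
  have hS₁L : S₁ < L := hS₁S.trans_le hSL
  have hvm : ∀ {s T' : ℝ}, 0 ≤ s → T' ≤ S₁ → AEStronglyMeasurable (uncurry v)
      ((volume : Measure (ℝ × EuclideanSpace ℝ (Fin 3))).restrict (Ioo s T' ×ˢ univ)) := by
    intro s T' hs hT'
    have hsub : Ioo s T' ×ˢ (univ : Set (EuclideanSpace ℝ (Fin 3))) ⊆ Ioo (-δ₀) S ×ˢ univ :=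
      prod_mono (Ioo_subset_Ioo (by linarith) (hT'.trans hS₁S.le)) Subset.rfl
    exact (hvc.mono hsub).aestronglyMeasurable (measurableSet_Ioo.prod MeasurableSet.univ)
  have hVm : ∀ {s T' : ℝ}, 0 ≤ s → T' ≤ S₁ → AEStronglyMeasurable (uncurry V)
      ((volume : Measure (ℝ × EuclideanSpace ℝ (Fin 3))).restrict (Ioo s T' ×ˢ univ)) := by
    intro s T' hs hT'
    have hsub : Ioo s T' ×ˢ (univ : Set (EuclideanSpace ℝ (Fin 3))) ⊆ Ioo 0 L ×ˢ univ :=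
      prod_mono (Ioo_subset_Ioo hs (hT'.trans hS₁L.le)) Subset.rfl
    exact (hVc.mono hsub).aestronglyMeasurable (measurableSet_Ioo.prod MeasurableSet.univ)
  have hvbd' : ∀ {s T' : ℝ}, 0 ≤ s → T' ≤ S₁ → ∀ t ∈ Ioo s T', ∀ x, ‖v t x‖ ≤ M' :=
    fun hs hT' t ht x => (hMv t ⟨hs.trans ht.1.le, ht.2.le.trans hT'⟩ x).trans hMvM'
  have hVbd' : ∀ {s T' : ℝ}, 0 ≤ s → T' ≤ S₁ → ∀ t ∈ Ioo s T', ∀ x, ‖V t x‖ ≤ M' :=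
    fun hs hT' t ht x => (hVbd t ⟨hs.trans_lt ht.1, ht.2.trans_le (hT'.trans hS₁L.le)⟩ x).trans hMM'
  have hvslc : ∀ t ∈ Ico 0 S, Continuous (v t) := by
    intro t ht
    have h2 : ContinuousOn (uncurry v ∘ fun x : EuclideanSpace ℝ (Fin 3) => (t, x)) univ :=
      hvc.comp (continuousOn_const.prodMk continuousOn_id)
        (fun x _ => ⟨⟨by linarith [ht.1], ht.2⟩, mem_univ _⟩)
    exact continuousOn_univ.1 h2
  have hVslc : ∀ t ∈ Ioo 0 L, Continuous (V t) := by
    intro t ht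
    have h2 : ContinuousOn (uncurry V ∘ fun x : EuclideanSpace ℝ (Fin 3) => (t, x)) univ :=
      hVc.comp (continuousOn_const.prodMk continuousOn_id) (fun x _ => ⟨ht, mem_univ _⟩)
    exact continuousOn_univ.1 h2
  set Λ₀ : ℝ≥0∞ := eLpNorm (fun x => v 0 x - V₀ x) 2 volume with hΛ₀
  have hΛ₀t : Λ₀ ≠ ⊤ := hU₀.eLpNorm_ne_top
  -- ### the first block
  have hfirst : ∀ t ∈ Ioo 0 (min ℓ S₁), AEStronglyMeasurable (fun x => v t x - V t x) volume ∧
      eLpNorm (fun x => v t x - V t x) 2 volume ≤ 2 * Λ₀ := by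
    have hT' : (0 : ℝ) < min ℓ S₁ := lt_min hℓ0 hS₁
    have h := @hblock 0 (min ℓ S₁) M' v V (v 0) V₀ hT' hM'0 (hvm le_rfl (min_le_right _ _))
      (hVm le_rfl (min_le_right _ _)) (hvbd' le_rfl (min_le_right _ _)) (hVbd' le_rfl (min_le_right _ _))
      (hvslc 0 ⟨le_rfl, hS₁.trans hS₁S⟩) hV₀c (fun x => (hMv 0 ⟨le_rfl, hS₁.le⟩ x).trans hMvM')
      (fun x => (hV₀bd x).trans hMM') hU₀
      (fun t ht => by simpa only [sub_zero] using hvO 0 t (by linarith) ht.1 (ht.2.trans_le ((min_le_right _ _).trans hS₁S.le)))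
      (fun t ht => by simpa only [sub_zero] using hVeq t ⟨ht.1, ht.2.trans_le ((min_le_right _ _).trans hS₁L.le)⟩)
      (hsmall hT' (by rw [sub_zero]; exact min_le_left _ _))
    exact h
  -- ### induction over the blocks `((k+1)ℓ/2, (k+3)ℓ/2 ∧ S₁)`
  have hind : ∀ k : ℕ, ∀ t ∈ Ioo 0 (min ((k + 2 : ℝ) * (ℓ / 2)) S₁),
      AEStronglyMeasurable (fun x => v t x - V t x) volume ∧
      eLpNorm (fun x => v t x - V t x) 2 volume ≤ 2 ^ (k + 1) * Λ₀ := by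
    intro k
    induction k with
    | zero =>
      intro t ht
      have ht' : t ∈ Ioo 0 (min ℓ S₁) := by
        refine ⟨ht.1, ?_⟩
        have := ht.2
        simp only [CharP.cast_eq_zero, zero_add] at this
        rwa [show (2 : ℝ) * (ℓ / 2) = ℓ by ring] at this
      obtain ⟨hm, hb⟩ := hfirst t ht'
      exact ⟨hm, by simpa using hb⟩
    | succ k ih =>
      intro t ht
      set s : ℝ := (k + 1 : ℝ) * (ℓ / 2) with hs
      have hs0 : 0 < s := by positivity
      by_cases htk : t < min ((k + 2 : ℝ) * (ℓ / 2)) S₁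
      · obtain ⟨hm, hb⟩ := ih t ⟨ht.1, htk⟩
        refine ⟨hm, hb.trans ?_⟩
        gcongr
        · exact one_le_two
        · exact Nat.le_succ _
      · -- `t` lies in the new block `(s, min (s + ℓ) S₁)`
        rw [not_lt, min_le_iff] at htk
        have htS₁ : t < S₁ := lt_of_lt_of_le ht.2 (min_le_right _ _)
        have htk' : (k + 2 : ℝ) * (ℓ / 2) ≤ t := by
          rcases htk with h | h
          · exact h
          · exact absurd htS₁ (not_lt.2 h)
        have hst : s < t := by
          rw [hs]; nlinarith [htk', hℓ0]
        have hsS₁ : s < S₁ := hst.trans htS₁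
        set T' : ℝ := min (s + ℓ) S₁ with hT'
        have htT' : t < T' := by
          refine lt_min ?_ htS₁
          have h1 : t < ((k + 1 : ℕ) + 2 : ℝ) * (ℓ / 2) := lt_of_lt_of_le ht.2 (min_le_left _ _)
          have h2 : ((k + 1 : ℕ) + 2 : ℝ) * (ℓ / 2) = s + ℓ := by rw [hs]; push_cast; ring
          linarith
        have hsT' : s < T' := hst.trans htT'
        have hT'S₁ : T' ≤ S₁ := min_le_right _ _
        -- the datum of the block: `‖v s − V s‖₂ ≤ 2^(k+1) Λ₀` from the induction hypothesis
        have hsI : s ∈ Ioo 0 (min ((k + 2 : ℝ) * (ℓ / 2)) S₁) := by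
          refine ⟨hs0, lt_min ?_ hsS₁⟩
          rw [hs]; nlinarith [hℓ0]
        obtain ⟨hsm, hsb⟩ := ih s hsI
        have hsS : s ∈ Ico 0 S := ⟨hs0.le, hsS₁.trans hS₁S⟩
        have hsL : s ∈ Ioo 0 L := ⟨hs0, hsS₁.trans hS₁L⟩
        have hvs_c : Continuous (v s) := hvslc s hsS
        have hVs_c : Continuous (V s) := hVslc s hsL
        have hvs_bd : ∀ x, ‖v s x‖ ≤ M' := fun x => (hMv s ⟨hs0.le, hsS₁.le⟩ x).trans hMvM'
        have hVs_bd : ∀ x, ‖V s x‖ ≤ M' := fun x => (hVbd s hsL x).trans hMM'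
        have hL2s : MemLp (fun x => v s x - V s x) 2 volume := by
          refine ⟨hsm, lt_of_le_of_lt hsb ?_⟩
          exact ENNReal.mul_lt_top (by simp) hΛ₀t.lt_top
        have h := @hblock s T' M' v V (v s) (V s) hsT' hM'0 (hvm hs0.le hT'S₁) (hVm hs0.le hT'S₁)
          (hvbd' hs0.le hT'S₁) (hVbd' hs0.le hT'S₁) hvs_c hVs_c hvs_bd hVs_bd hL2s
          (fun τ hτ => hvO s τ (by linarith) hτ.1 (hτ.2.trans_le (hT'S₁.trans hS₁S.le)))
          (fun τ hτ => hVO s τ hs0 hτ.1 (hτ.2.trans_le (hT'S₁.trans hS₁L.le)))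
          (hsmall hsT' (by rw [hT']; linarith [min_le_left (s + ℓ) S₁])) t ⟨hst, htT'⟩
        refine ⟨h.1, h.2.trans ?_⟩
        calc 2 * eLpNorm (fun x => v s x - V s x) 2 volume ≤ 2 * (2 ^ (k + 1) * Λ₀) :=
              mul_le_mul' le_rfl hsb
          _ = 2 ^ (k + 1 + 1) * Λ₀ := by ring
  -- ### the number of blocks
  obtain ⟨K, hK⟩ := exists_nat_ge (2 * S₁ / ℓ)
  have hcover : S₁ ≤ (K + 2 : ℝ) * (ℓ / 2) := by
    rw [div_le_iff₀ hℓ0] at hK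
    nlinarith [hK, hℓ0]
  refine ⟨ℓ, (2 ^ (K + 1) * Λ₀).toReal, hℓ0, fun t ht => ?_, fun t ht => (hfirst t ht).2⟩
  have ht' : t ∈ Ioo 0 (min ((K + 2 : ℝ) * (ℓ / 2)) S₁) := ⟨ht.1, lt_min (ht.2.trans_le hcover) ht.2⟩
  obtain ⟨hm, hb⟩ := hind K t ht'
  have htop : 2 ^ (K + 1) * Λ₀ ≠ ⊤ := ENNReal.mul_ne_top (by simp) hΛ₀t
  refine ⟨⟨hm, lt_of_le_of_lt hb htop.lt_top⟩, ?_⟩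
  rwa [ENNReal.ofReal_toReal htop]

end Blocks

/-! ### §3 The energy class up to the final time -/

section Energy

open scoped Laplacian RealInnerProductSpace

variable {S δ₀ L : ℝ} {v V : ℝ → EuclideanSpace ℝ (Fin 3) → EuclideanSpace ℝ (Fin 3)}
  {πv πV : ℝ → EuclideanSpace ℝ (Fin 3) → ℝ}
  {V₀ : EuclideanSpace ℝ (Fin 3) → EuclideanSpace ℝ (Fin 3)}

/-- `∫ ‖f‖² ≤ B²` when `‖f‖_{L²} ≤ B` (vector-valued `f ∈ L²`). [folklore] -/
theorem integral_norm_sq_le_of_eLpNorm_le {f : EuclideanSpace ℝ (Fin 3) → EuclideanSpace ℝ (Fin 3)}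
    (hf : MemLp f 2 volume) {B : ℝ} (hB : 0 ≤ B) (h : eLpNorm f 2 volume ≤ ENNReal.ofReal B) :
    Integrable (fun x => ‖f x‖ ^ 2) volume ∧ ∫ x, ‖f x‖ ^ 2 ≤ B ^ 2 := by
  have hn : MemLp (fun x => ‖f x‖) 2 volume := hf.norm
  have hn' : eLpNorm (fun x => ‖f x‖) 2 volume ≤ ENNReal.ofReal B := by rwa [eLpNorm_norm]
  obtain ⟨hi, hle⟩ := NormalisedPressureDifferenceMixed.integral_sq_le_of_eLpNorm_le hn hB hn'
  exact ⟨hi, hle⟩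

/-- **The remainder of the Calderón splitting is in the energy class up to the final time**
(Albritton 2018, proof of Prop. 4.5, (4.33): "`U ∈ L^∞_t L²_x ∩ L²_t Ḣ¹_x(Q_{T*})`"). Let
`(v, π_v)` be a classical solution of the unforced unit-viscosity system on `(-δ₀, S)`, bounded on
every `[0, S₁]`, `S₁ < S`, with slices bounded in `L^p` there (`2 < p < ∞`), satisfying the
Oseen integral identities from every time; let `(V, π_V)` be classical on `(0, L)`, `L ≥ S`,
`|V| ≤ M`, with slices bounded in `L^p`, the integral identity from time `0` with a continuous
datum `V₀`, `|V₀| ≤ M`, and from every positive time; and let `v(0) − V₀ ∈ L²` with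
`‖v(0) − V₀‖₂ ≤ Λ₀`. Then `W = v − V` satisfies `∫ |W(t)|² ≤ 4Λ₀² e^{M²t}` for `0 < t < S` and
`∫_{t₀}^{S} ∫ |∇W|²_F ≤ 4Λ₀²(1 + M²S)e^{M²S}` for `0 < t₀ < S` (§2 for `W ∈ L²` on closed
sub-slabs; the energy inequality `PerturbedEnergyInequality.energy_inequality` with the pressure
hypothesis `exists_sq_integrable_pressure_sub`; `S₁ ↑ S`). [cite: Albritton2018, Prop. 4.5 proof, (4.32)–(4.33)] -/
theorem remainder_energy_class (hS : 0 < S) (hδ₀ : 0 < δ₀) (hSL : S ≤ L)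
    (hv : IsClassicalNSSolutionOn (Ioo (-δ₀) S) 1 0 v πv)
    (hvO : ∀ s t : ℝ, -δ₀ < s → s < t → t < S → v t =ᵐ[volume] fun x =>
      UnboundedOperators.heatExtension (v s) (t - s) x - oseenDuhamel 1 s v v t x)
    (hvbd : ∀ S₁, S₁ < S → ∃ Mv : ℝ, ∀ t ∈ Icc 0 S₁, ∀ x, ‖v t x‖ ≤ Mv)
    {p : ℝ≥0∞} (hp₂ : 2 < p) (hp : p < ⊤)
    (hvp : ∀ S₁, S₁ < S → ∃ N : ℝ≥0, ∀ t ∈ Ioo 0 S₁, MemLp (v t) p volume ∧ eLpNorm (v t) p volume ≤ N)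
    (hV : IsClassicalNSSolutionOn (Ioo 0 L) 1 0 V πV) {M : ℝ} (hM : 0 < M)
    (hVbd : ∀ t ∈ Ioo 0 L, ∀ x, ‖V t x‖ ≤ M)
    (hVp : ∃ N : ℝ≥0, ∀ t ∈ Ioo 0 L, MemLp (V t) p volume ∧ eLpNorm (V t) p volume ≤ N)
    (hV₀c : Continuous V₀) (hV₀bd : ∀ x, ‖V₀ x‖ ≤ M)
    (hVeq : ∀ t ∈ Ioo 0 L, V t =ᵐ[volume] fun x =>
      UnboundedOperators.heatExtension V₀ t x - oseenDuhamel 1 0 V V t x)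
    (hVO : ∀ s t : ℝ, 0 < s → s < t → t < L → V t =ᵐ[volume] fun x =>
      UnboundedOperators.heatExtension (V s) (t - s) x - oseenDuhamel 1 s V V t x)
    {Λ₀ : ℝ} (hΛ₀ : 0 ≤ Λ₀) (hU₀ : MemLp (fun x => v 0 x - V₀ x) 2 volume)
    (hU₀b : eLpNorm (fun x => v 0 x - V₀ x) 2 volume ≤ ENNReal.ofReal Λ₀) :
    (∀ t ∈ Ioo 0 S, Integrable (fun x => ‖v t x - V t x‖ ^ 2) volume ∧
      ∫ x, ‖v t x - V t x‖ ^ 2 ≤ 4 * Λ₀ ^ 2 * Real.exp (M ^ 2 * t)) ∧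
    ∀ t₀ ∈ Ioo 0 S, ∫⁻ z in Ioo t₀ S ×ˢ (univ : Set (EuclideanSpace ℝ (Fin 3))),
        ENNReal.ofReal (frobeniusNormSq (fderiv ℝ (fun y => v z.1 y - V z.1 y) z.2)) ≤
      ENNReal.ofReal (4 * Λ₀ ^ 2 * (1 + M ^ 2 * S) * Real.exp (M ^ 2 * S)) := by
  have hvc : ContinuousOn (uncurry v) (Ioo (-δ₀) S ×ˢ univ) := hv.smooth_velocity.continuousOn
  have hVc : ContinuousOn (uncurry V) (Ioo 0 L ×ˢ univ) := hV.smooth_velocity.continuousOn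
  -- exponent bookkeeping for the pressure lemma: `2 (p/2) = p`, `1 < p/2 < ∞`
  have hP1 : (1 : ℝ≥0∞) < p / 2 := by
    rw [ENNReal.lt_div_iff_mul_lt (Or.inl two_ne_zero) (Or.inl ENNReal.ofNat_ne_top), one_mul]
    exact hp₂
  have hPt : p / 2 < ⊤ := ENNReal.div_lt_top hp.ne two_ne_zero
  have h2P : 2 * (p / 2) = p := ENNReal.mul_div_cancel two_ne_zero ENNReal.ofNat_ne_top
  obtain ⟨Cp, hCp0, hCp⟩ :=
    NormalisedPressureDifferenceMixed.exists_sq_integrable_pressure_sub (ν := (1 : ℝ)) zero_le_one hP1 hPt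
  obtain ⟨NV, hNV⟩ := hVp
  -- ### the energy inequality on `(0, S₁)`, `S₁ < S`, from a time `t₀` in the first block
  have key : ∀ {S₁ : ℝ}, 0 < S₁ → S₁ < S → ∃ ℓ : ℝ, 0 < ℓ ∧
      (∀ t ∈ Ioo 0 (min ℓ S₁), ∫ x, ‖v t x - V t x‖ ^ 2 ≤ 4 * Λ₀ ^ 2) ∧
      ∀ t₀ ∈ Ioo 0 S₁, ∀ t ∈ Ioo 0 S₁, t₀ ≤ t →
        (Integrable (fun x => ‖v t x - V t x‖ ^ 2) volume ∧
          (∫ x, ‖v t x - V t x‖ ^ 2) ≤ (∫ x, ‖v t₀ x - V t₀ x‖ ^ 2) * Real.exp (M ^ 2 * (t - t₀))) ∧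
        ∫⁻ z in Ioo t₀ t ×ˢ (univ : Set (EuclideanSpace ℝ (Fin 3))),
            ENNReal.ofReal (frobeniusNormSq (fderiv ℝ (fun y => v z.1 y - V z.1 y) z.2)) ≤
          ENNReal.ofReal ((∫ x, ‖v t₀ x - V t₀ x‖ ^ 2) * (1 + M ^ 2 * (t - t₀)) *
            Real.exp (M ^ 2 * (t - t₀))) := by
    intro S₁ hS₁ hS₁S
    have hS₁L : S₁ < L := hS₁S.trans_le hSL
    obtain ⟨ℓ, Λ₁, hℓ, hW, hfirst⟩ := sub_memLp_two_of_blocks hδ₀ hSL hvc hvO hvbd hVc hM hVbd hV₀c hV₀bd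
      hVeq hVO hU₀ hS₁ hS₁S
    -- the data of the energy inequality on `(0, S₁)`
    have hv' : IsClassicalNSSolutionOn (Ioo 0 S₁) 1 0 v πv :=
      hv.mono (Ioo_subset_Ioo (by linarith) hS₁S.le) (uniqueDiffOn_Ioo 0 S₁)
    have hV' : IsClassicalNSSolutionOn (Ioo 0 S₁) 1 0 V πV :=
      hV.mono (Ioo_subset_Ioo le_rfl hS₁L.le) (uniqueDiffOn_Ioo 0 S₁)
    obtain ⟨Mv, hMv⟩ := hvbd S₁ hS₁S
    set Mv' : ℝ := max Mv 0 with hMv'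
    have hMv'0 : 0 ≤ Mv' := le_max_right _ _
    have hvM : ∀ s ∈ Ioo 0 S₁, ∀ x, ‖v s x‖ ≤ Mv' := fun s hs x =>
      (hMv s ⟨hs.1.le, hs.2.le⟩ x).trans (le_max_left _ _)
    have hVM : ∀ s ∈ Ioo 0 S₁, ∀ x, ‖V s x‖ ≤ M := fun s hs x => hVbd s ⟨hs.1, hs.2.trans hS₁L⟩ x
    set Λ : ℝ := max Λ₁ 0 with hΛdef
    have hΛ0 : 0 ≤ Λ := le_max_right _ _
    have hWΛ : ∀ s ∈ Ioo 0 S₁, MemLp (fun x => v s x - V s x) 2 volume ∧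
        eLpNorm (fun x => v s x - V s x) 2 volume ≤ ENNReal.ofReal Λ := fun s hs =>
      ⟨(hW s hs).1, (hW s hs).2.trans (ENNReal.ofReal_le_ofReal (le_max_left _ _))⟩
    have hΛ' : ∀ s ∈ Ioo 0 S₁, Integrable (fun x => ‖v s x - V s x‖ ^ 2) volume ∧
        ∫ x, ‖v s x - V s x‖ ^ 2 ≤ Λ ^ 2 := fun s hs =>
      integral_norm_sq_le_of_eLpNorm_le (hWΛ s hs).1 hΛ0 (hWΛ s hs).2
    -- the pressure hypothesis
    obtain ⟨Nv, hNv⟩ := hvp S₁ hS₁S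
    set N : ℝ≥0 := max Nv NV with hN
    have hvN : ∀ s ∈ Ioo 0 S₁, MemLp (v s) (2 * (p / 2)) volume ∧ eLpNorm (v s) (2 * (p / 2)) volume ≤ N := by
      intro s hs; rw [h2P]
      exact ⟨(hNv s hs).1, (hNv s hs).2.trans (ENNReal.coe_le_coe.2 (le_max_left _ _))⟩
    have hVN : ∀ s ∈ Ioo 0 S₁, MemLp (V s) (2 * (p / 2)) volume ∧ eLpNorm (V s) (2 * (p / 2)) volume ≤ N := by
      intro s hs; rw [h2P]
      have hsL : s ∈ Ioo 0 L := ⟨hs.1, hs.2.trans hS₁L⟩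
      exact ⟨(hNV s hsL).1, (hNV s hsL).2.trans (ENNReal.coe_le_coe.2 (le_max_right _ _))⟩
    have hPb := hCp v V πv πV 0 S₁ hv' hV' N Mv' M Λ hMv'0 hM.le hΛ0 hvN hVN hvM hVM hWΛ
    refine ⟨ℓ, hℓ, fun t ht => ?_, fun t₀ ht₀ t ht ht₀t => ?_⟩
    · -- the first block: `‖W t‖₂ ≤ 2Λ₀`
      have hb : eLpNorm (fun x => v t x - V t x) 2 volume ≤ ENNReal.ofReal (2 * Λ₀) := by
        refine (hfirst t ht).trans ?_
        rw [ENNReal.ofReal_mul zero_le_two, ENNReal.ofReal_ofNat]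
        exact mul_le_mul' le_rfl hU₀b
      have htS₁ : t ∈ Ioo 0 S₁ := ⟨ht.1, lt_of_lt_of_le ht.2 (min_le_right _ _)⟩
      have h := (integral_norm_sq_le_of_eLpNorm_le (hW t htS₁).1 (by positivity) hb).2
      calc ∫ x, ‖v t x - V t x‖ ^ 2 ≤ (2 * Λ₀) ^ 2 := h
        _ = 4 * Λ₀ ^ 2 := by ring
    · have hE := PerturbedEnergyInequality.energy_inequality hv' hV' hMv'0 hM.le hvM hVM hΛ' hPb ht₀ ht ht₀t
      exact ⟨⟨(hΛ' t ht).1, hE.1⟩, hE.2⟩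
  refine ⟨fun t ht => ?_, fun t₀ ht₀ => ?_⟩
  · -- ### (i) the uniform `L²` bound at `t`
    set S₁ : ℝ := (t + S) / 2 with hS₁
    have htS₁ : t < S₁ := by rw [hS₁]; linarith [ht.2]
    have hS₁S : S₁ < S := by rw [hS₁]; linarith [ht.2]
    have hS₁0 : 0 < S₁ := ht.1.trans htS₁
    obtain ⟨ℓ, hℓ, hfirst, hmain⟩ := key hS₁0 hS₁S
    -- a time `t₀'` in the first block below `t`
    set t₀' : ℝ := min t (min ℓ S₁) / 2 with ht₀'
    have hm0 : 0 < min t (min ℓ S₁) := lt_min ht.1 (lt_min hℓ hS₁0)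
    have ht₀'0 : 0 < t₀' := by rw [ht₀']; positivity
    have ht₀'t : t₀' ≤ t := by
      rw [ht₀']; linarith [min_le_left t (min ℓ S₁)]
    have ht₀'b : t₀' < min ℓ S₁ := by
      rw [ht₀']; linarith [min_le_right t (min ℓ S₁)]
    have ht₀'S₁ : t₀' ∈ Ioo 0 S₁ := ⟨ht₀'0, lt_of_lt_of_le ht₀'b (min_le_right _ _)⟩
    obtain ⟨⟨hint, hle⟩, -⟩ := hmain t₀' ht₀'S₁ t ⟨ht.1, htS₁⟩ ht₀'t
    refine ⟨hint, hle.trans ?_⟩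
    have h1 := hfirst t₀' ⟨ht₀'0, ht₀'b⟩
    have h2 : Real.exp (M ^ 2 * (t - t₀')) ≤ Real.exp (M ^ 2 * t) :=
      Real.exp_le_exp.2 (mul_le_mul_of_nonneg_left (by linarith) (sq_nonneg M))
    have h0 : 0 ≤ ∫ x, ‖v t₀' x - V t₀' x‖ ^ 2 := integral_nonneg fun x => by positivity
    calc (∫ x, ‖v t₀' x - V t₀' x‖ ^ 2) * Real.exp (M ^ 2 * (t - t₀'))
        ≤ (4 * Λ₀ ^ 2) * Real.exp (M ^ 2 * t) := mul_le_mul h1 h2 (Real.exp_pos _).le (by positivity)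
      _ = 4 * Λ₀ ^ 2 * Real.exp (M ^ 2 * t) := by ring
  · -- ### (ii) the dissipation on `(t₀, S)`: monotone limit of the bounds on `(t₀, Sₙ)`
    set Sn : ℕ → ℝ := fun n => S - (S - t₀) / ((n : ℝ) + 2) with hSn
    have hSn_gt : ∀ n, t₀ < Sn n := by
      intro n
      have h2 : (1 : ℝ) < (n : ℝ) + 2 := by have := n.cast_nonneg (α := ℝ); linarith
      have hpos : 0 < S - t₀ := by linarith [ht₀.2]
      have : (S - t₀) / ((n : ℝ) + 2) < S - t₀ := div_lt_self hpos h2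
      simp only [hSn]; linarith
    have hSn_lt : ∀ n, Sn n < S := by
      intro n
      have hpos : 0 < (S - t₀) / ((n : ℝ) + 2) := by
        have : 0 < S - t₀ := by linarith [ht₀.2]
        positivity
      simp only [hSn]; linarith
    have hSn_mono : Monotone Sn := by
      intro m n hmn
      simp only [hSn]
      have hpos : 0 ≤ S - t₀ := by linarith [ht₀.2]
      have h1 : (m : ℝ) + 2 ≤ (n : ℝ) + 2 := by exact_mod_cast Nat.add_le_add_right hmn 2
      have h2 : (S - t₀) / ((n : ℝ) + 2) ≤ (S - t₀) / ((m : ℝ) + 2) :=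
        div_le_div_of_nonneg_left hpos (by positivity) h1
      linarith
    -- the bound on each `(t₀, Sₙ)`
    have hbound_n : ∀ n, ∫⁻ z in Ioo t₀ (Sn n) ×ˢ (univ : Set (EuclideanSpace ℝ (Fin 3))),
        ENNReal.ofReal (frobeniusNormSq (fderiv ℝ (fun y => v z.1 y - V z.1 y) z.2)) ≤
        ENNReal.ofReal (4 * Λ₀ ^ 2 * (1 + M ^ 2 * S) * Real.exp (M ^ 2 * S)) := by
      intro n
      set S₁ : ℝ := (Sn n + S) / 2 with hS₁
      have hSnS₁ : Sn n < S₁ := by rw [hS₁]; linarith [hSn_lt n]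
      have hS₁S : S₁ < S := by rw [hS₁]; linarith [hSn_lt n]
      have hS₁0 : 0 < S₁ := (ht₀.1.trans (hSn_gt n)).trans hSnS₁
      obtain ⟨ℓ, hℓ, hfirst, hmain⟩ := key hS₁0 hS₁S
      have ht₀S₁ : t₀ ∈ Ioo 0 S₁ := ⟨ht₀.1, (hSn_gt n).trans hSnS₁⟩
      obtain ⟨-, hD⟩ := hmain t₀ ht₀S₁ (Sn n) ⟨ht₀.1.trans (hSn_gt n), hSnS₁⟩ (hSn_gt n).le
      refine hD.trans (ENNReal.ofReal_le_ofReal ?_)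
      -- `e(t₀) ≤ 4Λ₀² e^{M² t₀}` by part (i) at `t₀` (re-derived from `hmain` on this slab)
      have he : ∫ x, ‖v t₀ x - V t₀ x‖ ^ 2 ≤ 4 * Λ₀ ^ 2 * Real.exp (M ^ 2 * t₀) := by
        set t₀' : ℝ := min t₀ (min ℓ S₁) / 2 with ht₀'
        have hm0 : 0 < min t₀ (min ℓ S₁) := lt_min ht₀.1 (lt_min hℓ hS₁0)
        have ht₀'0 : 0 < t₀' := by rw [ht₀']; positivity
        have ht₀'t : t₀' ≤ t₀ := by rw [ht₀']; linarith [min_le_left t₀ (min ℓ S₁)]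
        have ht₀'b : t₀' < min ℓ S₁ := by rw [ht₀']; linarith [min_le_right t₀ (min ℓ S₁)]
        have ht₀'S₁ : t₀' ∈ Ioo 0 S₁ := ⟨ht₀'0, lt_of_lt_of_le ht₀'b (min_le_right _ _)⟩
        obtain ⟨⟨-, hle⟩, -⟩ := hmain t₀' ht₀'S₁ t₀ ht₀S₁ ht₀'t
        refine hle.trans ?_
        have h1 := hfirst t₀' ⟨ht₀'0, ht₀'b⟩
        have h2 : Real.exp (M ^ 2 * (t₀ - t₀')) ≤ Real.exp (M ^ 2 * t₀) :=
          Real.exp_le_exp.2 (mul_le_mul_of_nonneg_left (by linarith) (sq_nonneg M))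
        calc (∫ x, ‖v t₀' x - V t₀' x‖ ^ 2) * Real.exp (M ^ 2 * (t₀ - t₀'))
            ≤ (4 * Λ₀ ^ 2) * Real.exp (M ^ 2 * t₀) := mul_le_mul h1 h2 (Real.exp_pos _).le (by positivity)
          _ = 4 * Λ₀ ^ 2 * Real.exp (M ^ 2 * t₀) := by ring
      have he0 : 0 ≤ ∫ x, ‖v t₀ x - V t₀ x‖ ^ 2 := integral_nonneg fun x => by positivity
      have hdt : Sn n - t₀ ≤ S - t₀ := by linarith [hSn_lt n]
      have h3 : 1 + M ^ 2 * (Sn n - t₀) ≤ 1 + M ^ 2 * S := by nlinarith [sq_nonneg M, ht₀.1, hSn_lt n]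
      have h4 : Real.exp (M ^ 2 * t₀) * Real.exp (M ^ 2 * (Sn n - t₀)) ≤ Real.exp (M ^ 2 * S) := by
        rw [← Real.exp_add]
        exact Real.exp_le_exp.2 (by nlinarith [sq_nonneg M, hSn_lt n])
      have hc0 : 0 ≤ 1 + M ^ 2 * (Sn n - t₀) :=
        add_nonneg zero_le_one (mul_nonneg (sq_nonneg _) (by linarith [hSn_gt n]))
      calc (∫ x, ‖v t₀ x - V t₀ x‖ ^ 2) * (1 + M ^ 2 * (Sn n - t₀)) * Real.exp (M ^ 2 * (Sn n - t₀))
          ≤ (4 * Λ₀ ^ 2 * Real.exp (M ^ 2 * t₀)) * (1 + M ^ 2 * S) * Real.exp (M ^ 2 * (Sn n - t₀)) :=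
            mul_le_mul (mul_le_mul he h3 hc0 (by positivity)) le_rfl (Real.exp_pos _).le (by positivity)
        _ = 4 * Λ₀ ^ 2 * (1 + M ^ 2 * S) * (Real.exp (M ^ 2 * t₀) * Real.exp (M ^ 2 * (Sn n - t₀))) := by ring
        _ ≤ 4 * Λ₀ ^ 2 * (1 + M ^ 2 * S) * Real.exp (M ^ 2 * S) := by gcongr
    -- `(t₀, S) = ⋃ₙ (t₀, Sₙ)`
    have hunion : Ioo t₀ S ×ˢ (univ : Set (EuclideanSpace ℝ (Fin 3))) =
        ⋃ n, Ioo t₀ (Sn n) ×ˢ (univ : Set (EuclideanSpace ℝ (Fin 3))) := by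
      rw [← iUnion_prod_const]
      congr 1
      ext t
      simp only [mem_Ioo, mem_iUnion]
      constructor
      · rintro ⟨h1, h2⟩
        -- `Sₙ → S`, so `t < Sₙ` for large `n`
        have hpos : 0 < S - t := by linarith
        obtain ⟨n, hn⟩ := exists_nat_gt ((S - t₀) / (S - t))
        refine ⟨n, h1, ?_⟩
        simp only [hSn]
        have hn2 : (S - t₀) / (S - t) < (n : ℝ) + 2 := by linarith
        rw [div_lt_iff₀ hpos] at hn2
        have : (S - t₀) / ((n : ℝ) + 2) < S - t := by
          rw [div_lt_iff₀ (by positivity)]; linarith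
        linarith
      · rintro ⟨n, h1, h2⟩
        exact ⟨h1, h2.trans (hSn_lt n)⟩
    have hdir : Directed (· ⊆ ·) fun n => Ioo t₀ (Sn n) ×ˢ (univ : Set (EuclideanSpace ℝ (Fin 3))) := by
      refine Monotone.directed_le fun m n hmn => ?_
      exact prod_mono (Ioo_subset_Ioo_right (hSn_mono hmn)) Subset.rfl
    rw [hunion, setLIntegral_iUnion_of_directed _ hdir]
    exact iSup_le hbound_n

end Energy

end RemainderEnergyClass

end Literature.Analysis.FluidPDE

end
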